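import Literature.MathematicalPhysics.QuantumFieldTheory.Balaban1983to89.B3Taylor310LocalRemainder
import Literature.MathematicalPhysics.QuantumFieldTheory.Balaban1983to89.B5Eq120IterProof

/-!
# `Balaban1983to89.B3ConstantField433` — T. Bałaban, *(Higgs)₂,₃ quantum fields in a finite volume. III. Renormalization*,
Commun. Math. Phys. **88** (1983) 411–445 [Balaban1983Higgs3], p. 433 [PDF 23]: the sentence of the reduction narrative of Sect. 3
*"The field B̃ is regular in the sense that ‖∂^η_μB̃‖_{0,Λ} ≤ O(p(L^kε)). Hence there exists a constant field B̃₀ such that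
|B̃ − B̃₀| ≤ O(r(L^kε)p(L^kε)) ≤ O(p(L^kε)²) on the cube □"* — a lattice mean-value lemma — PROVED on the torus calculus of the series

statement-level skeleton of published theorems with citation tags; proofs where landed; nothing here is a claim about the Yang–Mills mass gap

PDF held: `paper:balaban1983-higgs-2-3-quantum-fields-finite-volume` (journal page = PDF page + 410); p. 433 materialised
(`lit read … --pages 23`, `p0023.txt` ll. 12–14) and read 2026-08-21.

CITATION HEADER (lean-in-tree rule).  Part of the lit-balaban TYPED SKELETON (HOME `run/shared/lean/pub/lit-balaban/`), unit
`lit-balaban-r15` (reader/typer and fold owner of block B3), generation 7.  WHAT IS REPRODUCED: row **B3.Txt@433** of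
`HOME/lit-balaban-r15/ROWS-B3.md` (p. 433, the reduction steps), second proved member (the first is p18's `B3PropagatorChains433`, the
chain sentence).  Inputs BY NAME: r18's `LatticeFieldCalculus` (`pdiff`, `grad`, `runSum`, `mixSite`, `stairSum` = the sum of a bond field
along the staircase contour `Γ_{y,x}`), pub-balaban's telescoping `B5Eq120IterProof.stairSum_grad` (`(∂λ)(Γ_{y,x}) = c·(λ(x) − λ(y))`),
p20's contour geometry `B3Taylor310Remainder.steps`/`tdist_runSite_mixSite_le`/`tdist_downSite_mixSite_le` (every site of `Γ_{y,x}`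
stays within `ℓ¹`-distance `|x − y|₁` of `y`) and `B3Taylor310LocalRemainder.tdist_eq_sum_natAbs`/`tdist_comm`/`tdist_self`.

THE PRINTED TEXT (verbatim, p. 433 [PDF 23]).  *"We take a cube □₁ of size r(L^kε) containing the above cube in the center, and next
we take a cube □ of size 3r(L^kε) and with □₁ in the center. … The field B̃ is regular in the sense that ‖∂^η_μB̃‖_{0,Λ} ≤ O(p(L^kε)).
Hence there exists a constant field B̃₀ such that |B̃ − B̃₀| ≤ O(r(L^kε)p(L^kε)) ≤ O(p(L^kε)²) on the cube □. We have B̃ = B̃₀ + B̃′,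
and we expand in B̃′ …"*.

WHAT IS PROVED, and how (theorems only; D-0026: no `def`, no named fact; standard axioms).
* `norm_runSum_steps_le_local`, **`norm_stairSum_le_local`**: `‖A(Γ_{y,x})‖ ≤ |x − y|₁ · a` whenever `‖A(b)‖ ≤ a` for the bonds `b`
  whose base point lies in the `ℓ¹`-ball of radius `|x − y|₁` about `y` — the staircase has `|x − y|₁` bonds (`Σ_μ |n_μ| = |x − y|₁`,
  `sum_natAbs_steps_eq_tdist`) and all of them start inside that ball; `norm_stairSum_le_tdist` is the global-sup form.
* `sub_eq_smul_stairSum_grad`: `f(x) − f(y) = η · (∂^ηf)(Γ_{y,x})` (`stairSum_grad` at `c = η⁻¹`).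
* **`norm_sub_le_local`**: if `‖(∂^η_μ f)(z)‖ ≤ P` for all directions `μ` and all `z` with `|z − y|₁ ≤ |x − y|₁`, then
  `‖f(x) − f(y)‖ ≤ η|x − y|₁ · P`; global form `norm_sub_le_tdist`.
* **`norm_sub_center_le`** / **`exists_constantField`** (THE PRINTED SENTENCE): if `‖∂^η_μ f‖ ≤ P` on the `ℓ¹`-ball of radius `R`
  (lattice steps) about `y` — the print's regularity `‖∂^η_μB̃‖_{0,Λ} ≤ O(p(L^kε))` on a region `Λ ⊇ □` — then the CONSTANT `B̃₀ := f(y)`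
  satisfies `‖f(x) − B̃₀‖ ≤ (ηR)·P` for every `x` in that ball: with `ηR = O(r(L^kε))` (the size of □) and `P = O(p(L^kε))` this is the
  printed `|B̃ − B̃₀| ≤ O(r(L^kε)p(L^kε))`; **`exists_constantVecField`**: the same for a bond (vector) field `B̃`, componentwise
  (`B̃₀` = the constant vector field with components `B̃(⟨y, ν⟩)`).
READING NOTES. (i) The cube □ is replaced by the `ℓ¹`-ball `{x : |x − y|₁ ≤ R}` of the torus `T^{(j)}` (it contains every cube of
`ℓ¹`-radius `R` about `y`; the staircases `Γ_{y,x}` to its points stay inside it) — the print's `|·|` is a lattice distance with an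
unspecified norm (`Setup` DIVERGENCE F2).  (ii) The further printed bound `≤ O(p(L^kε)²)` uses `r(γ) ≤ O(p(γ))` for the functions `r`, `p`
of [Balaban1982Higgs1]; it is arithmetic on the constants and is not restated.  (iii) Nothing here concerns the expansion in `B̃′` by
(I.3.14), (I.3.44)–(I.3.45) or the gauge transformation removing `B̃₀` (Lemma II.2.4) — the rest of the p. 433 narrative (row B3.Txt@433,
untyped prose).  Unit `lit-balaban-r15` (literature-prover-lit-balaban-r15-g7-0), 2026-08-21; HOME/FILED.md records the proposal.
-/

open scoped BigOperators

namespace Literature.MathematicalPhysics.QuantumFieldTheory.Balaban1983to89.B3ConstantField433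

open LatticeFieldCalculus B3Taylor310Remainder B3Taylor310LocalRemainder

/-! ## 1. The staircase sum under a local sup bound -/

section Stair

variable {P : Params} {j : ℕ} {V : Type*} [NormedAddCommGroup V] [NormedSpace ℝ V]

/-- kernel: the `μ`-coordinate of the corner `mixSite μ y x` of `Γ_{y,x}` is `y_μ`. [folklore] -/
private theorem mixSite_self' (μ : Fin P.d) (y x : Site P j) : mixSite μ y x μ = y μ := by
  simp [mixSite]

/-- The number of bonds of `Γ_{y,x}` is the `ℓ¹` torus distance: `Σ_μ |n_μ| = |x − y|₁` (lattice steps), with the signed step numbers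
`n_μ = steps y x μ` of `LatticeFieldCalculus.stairSum`. [cite: Balaban1983Higgs3, (3.10) p.435] -/
theorem sum_natAbs_steps_eq_tdist (y x : Site P j) : ∑ μ : Fin P.d, (steps y x μ).natAbs = Site.tdist y x := by
  rw [← sum_steps_eq_tdist y x]
  exact Finset.sum_congr rfl fun μ _ => (Int.toNat_add_toNat_neg_eq_natAbs _).symm

omit [NormedSpace ℝ V] in
/-- ONE RUN of the staircase under a LOCAL bound: if `‖A(b)‖ ≤ a` for every bond `b` whose base point is within `ℓ¹`-distance `|x − y|₁`
of `y`, then the signed sum of `A` along the run of `Γ_{y,x}` in the direction `μ` (`n_μ` bonds, forward or backward) is at most `|n_μ|·a`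
in norm. [cite: Balaban1983Higgs3, p.433] -/
theorem norm_runSum_steps_le_local (A : VecField P j V) (y x : Site P j) (μ : Fin P.d) {a : ℝ}
    (hA : ∀ (z : Site P j) (ν : Fin P.d), Site.tdist z y ≤ Site.tdist y x → ‖A ⟨z, ν⟩‖ ≤ a) :
    ‖runSum A (mixSite μ y x) μ (steps y x μ)‖ ≤ ((steps y x μ).natAbs : ℝ) * a := by
  rcases Int.eq_nat_or_neg (steps y x μ) with ⟨n, hn | hn⟩
  · -- forward run: bonds `⟨p + t e_μ, μ⟩`, `t < n`, all based within `|x − y|₁` of `y`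
    have hnat : (steps y x μ).natAbs = n := by rw [hn]; simp
    rw [hnat, hn, runSum_ofNat, segSum]
    calc ‖∑ t ∈ Finset.range n, A (runBond (mixSite μ y x) μ t)‖
        ≤ ∑ t ∈ Finset.range n, ‖A (runBond (mixSite μ y x) μ t)‖ := norm_sum_le _ _
      _ ≤ ∑ _t ∈ Finset.range n, a := by
          refine Finset.sum_le_sum fun t ht => hA (runSite (mixSite μ y x) μ t) μ ?_
          refine tdist_runSite_mixSite_le y x μ ?_
          have h1 : t < n := Finset.mem_range.mp ht
          omega
      _ = (n : ℝ) * a := by rw [Finset.sum_const, Finset.card_range, nsmul_eq_mul]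
  · -- backward run: reversed bonds based at `p − (t+1)e_μ`, `t < n`, all based within `|x − y|₁` of `y`
    have hnat : (steps y x μ).natAbs = n := by rw [hn]; simp
    cases n with
    | zero =>
      simp only [Nat.cast_zero, neg_zero] at hn
      rw [hn, runSum_zero, norm_zero]
      simp
    | succ n =>
      have hneg : -((n + 1 : ℕ) : ℤ) = Int.negSucc n := rfl
      rw [hnat, hn, hneg]
      simp only [runSum, norm_neg]
      calc ‖∑ t ∈ Finset.range (n + 1), A ⟨Function.update (mixSite μ y x) μ (mixSite μ y x μ - (t + 1 : ℕ)), μ⟩‖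
          ≤ ∑ t ∈ Finset.range (n + 1), ‖A ⟨Function.update (mixSite μ y x) μ (mixSite μ y x μ - (t + 1 : ℕ)), μ⟩‖ :=
            norm_sum_le _ _
        _ ≤ ∑ _t ∈ Finset.range (n + 1), a := by
            refine Finset.sum_le_sum fun t ht => hA _ μ ?_
            rw [mixSite_self']
            refine tdist_downSite_mixSite_le y x μ (t := t + 1) ?_
            have h1 : t < n + 1 := Finset.mem_range.mp ht
            omega
        _ = ((n + 1 : ℕ) : ℝ) * a := by rw [Finset.sum_const, Finset.card_range, nsmul_eq_mul]

omit [NormedSpace ℝ V] in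
/-- **The staircase sum under a LOCAL sup bound**: `‖A(Γ_{y,x})‖ ≤ |x − y|₁ · a` whenever `‖A(b)‖ ≤ a` for the bonds based in the `ℓ¹`-ball
of radius `|x − y|₁` about `y` (which contains every site of `Γ_{y,x}`); `|x − y|₁ = Site.tdist y x` in lattice steps.
[cite: Balaban1983Higgs3, p.433] -/
theorem norm_stairSum_le_local (A : VecField P j V) (y x : Site P j) {a : ℝ}
    (hA : ∀ (z : Site P j) (ν : Fin P.d), Site.tdist z y ≤ Site.tdist y x → ‖A ⟨z, ν⟩‖ ≤ a) :
    ‖stairSum A y x‖ ≤ (Site.tdist y x : ℝ) * a := by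
  unfold stairSum
  calc ‖∑ μ : Fin P.d, runSum A (mixSite μ y x) μ (x μ - y μ).valMinAbs‖
      ≤ ∑ μ : Fin P.d, ‖runSum A (mixSite μ y x) μ (steps y x μ)‖ := norm_sum_le _ _
    _ ≤ ∑ μ : Fin P.d, ((steps y x μ).natAbs : ℝ) * a := Finset.sum_le_sum fun μ _ => norm_runSum_steps_le_local A y x μ hA
    _ = (Site.tdist y x : ℝ) * a := by
        rw [← Finset.sum_mul, ← sum_natAbs_steps_eq_tdist y x]; push_cast; rfl

omit [NormedSpace ℝ V] in
/-- Global-sup form: `‖A(Γ_{y,x})‖ ≤ |x − y|₁ · sup‖A‖` for ALL sites `y, x` of the torus (p27/p08's `BIJ85GaugeFnBound513.norm_stairSum_le`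
is the block-site case). [cite: Balaban1983Higgs3, p.433] -/
theorem norm_stairSum_le_tdist (A : VecField P j V) {a : ℝ} (hA : ∀ b, ‖A b‖ ≤ a) (y x : Site P j) :
    ‖stairSum A y x‖ ≤ (Site.tdist y x : ℝ) * a :=
  norm_stairSum_le_local A y x fun z ν _ => hA ⟨z, ν⟩

end Stair

/-! ## 2. The mean-value bound and the constant field `B̃₀` -/

section MeanValue

variable {P : Params} {j : ℕ} {V : Type*} [NormedAddCommGroup V] [NormedSpace ℝ V]

/-- Telescoping along `Γ_{y,x}` with the `η`-lattice derivative: `f(x) − f(y) = η · (∂^ηf)(Γ_{y,x})`, `∂^ηf = grad η⁻¹ f`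
(pub-balaban's `stairSum_grad` at `c = η⁻¹`). [cite: Balaban1983Higgs3, (3.10) p.435] -/
theorem sub_eq_smul_stairSum_grad {η : ℝ} (hη : η ≠ 0) (f : SiteField P j V) (y x : Site P j) :
    f x - f y = η • stairSum (grad η⁻¹ f) y x := by
  rw [B5Eq120IterProof.stairSum_grad, smul_smul, mul_inv_cancel₀ hη, one_smul]

/-- **Lattice mean-value bound, LOCAL form**: if `‖(∂^η_μ f)(z)‖ ≤ P` for every direction `μ` and every site `z` with
`|z − y|₁ ≤ |x − y|₁`, then `‖f(x) − f(y)‖ ≤ η|x − y|₁ · P` (`η > 0` the lattice spacing, `|·|₁ = Site.tdist` in lattice steps).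
[cite: Balaban1983Higgs3, p.433] -/
theorem norm_sub_le_local {η : ℝ} (hη : 0 < η) (f : SiteField P j V) (y x : Site P j) {Pb : ℝ}
    (hf : ∀ (z : Site P j) (μ : Fin P.d), Site.tdist z y ≤ Site.tdist y x → ‖pdiff η⁻¹ μ f z‖ ≤ Pb) :
    ‖f x - f y‖ ≤ η * (Site.tdist y x : ℝ) * Pb := by
  rw [sub_eq_smul_stairSum_grad hη.ne' f y x, norm_smul, Real.norm_of_nonneg hη.le, mul_assoc]
  refine mul_le_mul_of_nonneg_left (norm_stairSum_le_local _ y x fun z ν hz => ?_) hη.le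
  rw [grad_apply]
  exact hf z ν hz

/-- Global form: `‖∂^η_μ f‖ ≤ P` everywhere ⇒ `‖f(x) − f(y)‖ ≤ η|x − y|₁ · P` for all `x, y`. [cite: Balaban1983Higgs3, p.433] -/
theorem norm_sub_le_tdist {η : ℝ} (hη : 0 < η) (f : SiteField P j V) {Pb : ℝ} (hf : ∀ (z : Site P j) (μ : Fin P.d), ‖pdiff η⁻¹ μ f z‖ ≤ Pb)
    (y x : Site P j) : ‖f x - f y‖ ≤ η * (Site.tdist y x : ℝ) * Pb :=
  norm_sub_le_local hη f y x fun z μ _ => hf z μ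

/-- **p. 433, «there exists a constant field B̃₀ such that |B̃ − B̃₀| ≤ O(r(L^kε)p(L^kε)) on the cube □», with the constant exhibited**:
if `‖(∂^η_μ f)(z)‖ ≤ P` for all `μ` and all `z` in the `ℓ¹`-ball of radius `R` (lattice steps) about `y` — the print's regularity
`‖∂^η_μB̃‖_{0,Λ} ≤ O(p(L^kε))` — then `B̃₀ := f(y)` satisfies `‖f(x) − B̃₀‖ ≤ (ηR)·P` for every `x` in that ball (`ηR = O(r(L^kε))` the size of
□, `P = O(p(L^kε))`). [cite: Balaban1983Higgs3, p.433] -/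
theorem norm_sub_center_le {η : ℝ} (hη : 0 < η) (f : SiteField P j V) (y : Site P j) (R : ℕ) {Pb : ℝ} (hP : 0 ≤ Pb)
    (hf : ∀ (z : Site P j) (μ : Fin P.d), Site.tdist z y ≤ R → ‖pdiff η⁻¹ μ f z‖ ≤ Pb)
    {x : Site P j} (hx : Site.tdist y x ≤ R) :
    ‖f x - f y‖ ≤ η * (R : ℝ) * Pb := by
  calc ‖f x - f y‖ ≤ η * (Site.tdist y x : ℝ) * Pb :=
        norm_sub_le_local hη f y x fun z μ hz => hf z μ (hz.trans hx)
    _ ≤ η * (R : ℝ) * Pb := by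
        refine mul_le_mul_of_nonneg_right (mul_le_mul_of_nonneg_left ?_ hη.le) hP
        exact_mod_cast hx

/-- **THE PRINTED SENTENCE (p. 433)**, verbatim: *"The field B̃ is regular in the sense that ‖∂^η_μB̃‖_{0,Λ} ≤ O(p(L^kε)). Hence there
exists a constant field B̃₀ such that |B̃ − B̃₀| ≤ O(r(L^kε)p(L^kε)) … on the cube □"* — for a site field `f` (any normed space of
values, e.g. the Lie-algebra-valued components of `B̃`): a sup bound `P` on the `η`-lattice derivatives on the `ℓ¹`-ball of radius `R`
about `y` gives a constant `B̃₀` with `‖f(x) − B̃₀‖ ≤ (ηR)·P` on that ball. [cite: Balaban1983Higgs3, p.433] -/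
theorem exists_constantField {η : ℝ} (hη : 0 < η) (f : SiteField P j V) (y : Site P j) (R : ℕ) {Pb : ℝ} (hP : 0 ≤ Pb)
    (hf : ∀ (z : Site P j) (μ : Fin P.d), Site.tdist z y ≤ R → ‖pdiff η⁻¹ μ f z‖ ≤ Pb) :
    ∃ B₀ : V, ∀ x : Site P j, Site.tdist y x ≤ R → ‖f x - B₀‖ ≤ η * (R : ℝ) * Pb :=
  ⟨f y, fun _ hx => norm_sub_center_le hη f y R hP hf hx⟩

/-- **The printed sentence for a bond (vector) field `B̃`** (the external vector field of Sect. 3, one real component per bond):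
if every component `z ↦ B̃(⟨z, ν⟩)` has `η`-lattice derivatives bounded by `P` on the `ℓ¹`-ball of radius `R` about `y`, then the CONSTANT
vector field `B̃₀` with components `B̃(⟨y, ν⟩)` satisfies `|B̃(⟨x, ν⟩) − B̃₀,ν| ≤ (ηR)·P` for every `x` in the ball and every `ν` — *"there
exists a constant field B̃₀ such that |B̃ − B̃₀| ≤ O(r(L^kε)p(L^kε)) on the cube □"*. [cite: Balaban1983Higgs3, p.433] -/
theorem exists_constantVecField {η : ℝ} (hη : 0 < η) (B : VecField P j ℝ) (y : Site P j) (R : ℕ) {Pb : ℝ} (hP : 0 ≤ Pb)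
    (hB : ∀ (z : Site P j) (μ ν : Fin P.d), Site.tdist z y ≤ R → |pdiff η⁻¹ μ (fun w => B ⟨w, ν⟩) z| ≤ Pb) :
    ∃ b₀ : Fin P.d → ℝ, ∀ x : Site P j, Site.tdist y x ≤ R → ∀ ν : Fin P.d, |B ⟨x, ν⟩ - b₀ ν| ≤ η * (R : ℝ) * Pb := by
  refine ⟨fun ν => B ⟨y, ν⟩, fun x hx ν => ?_⟩
  have h := norm_sub_center_le hη (fun w => B ⟨w, ν⟩) y R hP (fun z μ hz => ?_) hx
  · simpa only [Real.norm_eq_abs] using h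
  · rw [Real.norm_eq_abs]; exact hB z μ ν hz

end MeanValue

end Literature.MathematicalPhysics.QuantumFieldTheory.Balaban1983to89.B3ConstantField433
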